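import Literature.AnabelianGeometry.EtaleTheta.ThetaRigidityLevels
import Literature.AnabelianGeometry.EtaleTheta.ThetaRigidityToy
import Mathlib.GroupTheory.SpecificGroups.Cyclic
import HarnessLib

/-!
# [EtTh] Cor. 2.18 (iii), second part (`Π•_X ≅ Π^tp_X`, i.e. `Π^tp_X → Aut(Π^tp_Y)` injective) HOLDS at a toy with
# NON-ABELIAN `Π^tp_Y` — FACT row F-0622 `RigidData.Cor218_iii_PiX` (and F-0636) instance-PROVED (proof-only)

S. Mochizuki, *The Étale Theta Function …* [EtTh], Publ. RIMS **45** (2009), §2, Cor. 2.18 (iii) p. 61 ("the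
construction of `Π•_X` then follows immediately, in light of the temp-slimness of `Π•_X`": the kernel content is the
injectivity of conjugation `Π^tp_X → Aut(Π^tp_Y)`) (locators `p.N` = PDF pages; bib key `MochizukiEtTh2009`).

PROOF-ONLY (no `def`, no instance, no new named fact; cell `abc-iut`, seat abc-iut-w6-d089, rows F-0622
`RigidData.Cor218_iii_PiX` / F-0636 `ThetaEnvData.Cor218_iii_PiX`).  abc-iut-w5-d175 refuted the universal closure
(abelian toys: `Π^tp_Y` centralises itself); lane C2 has it at the model modulo temp-slimness.  An UNCONDITIONAL
instance needs `Π^tp_X = Π^tp_Y ⋊ ℤ` with `Z(Π^tp_Y) = 1` and an outer action of `ℤ` no non-zero power of which is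
inner (`Out(ℤ_p ⋊ (1+pℤ_p))` is finite, so the Iwahori toy of `ThetaRigidityIwahoriCor218iii.lean` cannot serve).
The datum here (built inside the proof, discrete): `Π^tp_Y := ℤ² ⋊ {±1}` (inversion action; trivial centre),
`Π^tp_X := Π^tp_Y ⋊_τ ℤ` with `τ` the SHEAR `(a, b) ↦ (a + b, b)` (commutes with `−1`; `τⁿ|_{ℤ²} = [[1,n],[0,1]] ≠ ±1`
for `n ≠ 0`), `Π^tp_Ÿ := ℤ² ⋊ 1`, `G_K := 1`, `μ_2`, `(l·Δ_Θ) := Π^tp_Ÿ`, `thetaMod = η₀ : (a, b) ↦ b mod 2`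
(invariant under `±` and under the shear), `Ker(Π ↠ Π^Θ) := {b even}`, no cusps:
**`exists_rigidData_cor218_iii_PiX`** — `Π^tp_Y` is non-abelian and `Cor218_iii_PiX` HOLDS: an `x = (y, n)`
centralising `Π^tp_Y` fixes the translation `(0, 1)`, whence `±(n, 1) = (0, 1)`, so `n = 0` and `y` acts by `+1`;
then `x = (w, +1)` must commute with the reflection `(0, −1)`, whence `2w = 0`, `w = 0`.

HONEST FRAMING: a statement about the cell's own typing at one explicit (discrete) toy — a satisfiability witness,
nothing more; print's Cor. 2.18 (iii) (tempered π₁ of a specific curve) is neither proved nor refuted here; nothing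
bears on [IUTchIII] Cor. 3.12; no side taken; typed ≠ proved.
-/

namespace Literature.AnabelianGeometry.EtaleTheta

namespace RigidData

/-- **F-0622 at the shear toy.**  There is a `RigidData 2 1` with NON-ABELIAN `Π^tp_Y = ℤ² ⋊ {±1}` and
`Π^tp_X = Π^tp_Y ⋊_{shear} ℤ` at which `Cor218_iii_PiX` (conjugation `Π^tp_X → Aut(Π^tp_Y)` is injective) HOLDS.
[cite: MochizukiEtTh2009, Cor 2.18(iii) p.61] -/
theorem exists_rigidData_cor218_iii_PiX :
    ∃ R : RigidData.{0} 2 1, (∃ a b : R.PiY, a * b ≠ b * a) ∧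
      Literature.AnabelianGeometry.EtaleTheta.RigidData.Cor218_iii_PiX R := by
  have hcases : ∀ t : Multiplicative (ZMod 2), t = 1 ∨ t = Multiplicative.ofAdd 1 := by decide
  have hone : Multiplicative.ofAdd (1 : ZMod 2) ≠ 1 := by decide
  have hsq : ∀ t : Multiplicative (ZMod 2), t * t = 1 := by decide
  -- `V = ℤ²`, the inversion `σ`, and the action of `S = ℤ/2` through `σ`
  let V : Type := Multiplicative (ℤ × ℤ)
  let S : Type := Multiplicative (ZMod 2)
  let σ : MulAut V := MulEquiv.inv V
  have hσ : ∀ v : V, σ v = v⁻¹ := fun v => rfl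
  have hσσ : σ * σ = 1 := by
    refine MulEquiv.ext fun v => ?_
    rw [MulAut.mul_apply, hσ, hσ, inv_inv, MulAut.one_apply]
  let φ₁ : S →* MulAut V :=
    { toFun := fun s => if s = 1 then 1 else σ
      map_one' := if_pos rfl
      map_mul' := fun a b => by
        rcases hcases a with rfl | rfl <;> rcases hcases b with rfl | rfl
        · rw [one_mul, if_pos rfl, one_mul]
        · rw [one_mul, if_pos rfl, if_neg hone, one_mul]
        · rw [mul_one, if_neg hone, if_pos rfl, mul_one]
        · rw [hsq, if_pos rfl, if_neg hone, hσσ] }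
  have hφ₁0 : φ₁ 1 = 1 := map_one φ₁
  have hφ₁1 : φ₁ (Multiplicative.ofAdd 1) = σ := by
    change (if Multiplicative.ofAdd (1 : ZMod 2) = 1 then (1 : MulAut V) else σ) = σ
    rw [if_neg hone]
  have hφ₁v : ∀ (s : S) (v : V), φ₁ s v = v ∨ φ₁ s v = v⁻¹ := fun s v => by
    rcases hcases s with rfl | rfl
    · exact Or.inl (by rw [hφ₁0, MulAut.one_apply])
    · exact Or.inr (by rw [hφ₁1, hσ])
  -- `Π_Y := V ⋊ S`, the shear `τ`, `Π_X := Π_Y ⋊_τ ℤ`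
  let Y : Type := V ⋊[φ₁] S
  let shA : ℤ × ℤ ≃+ ℤ × ℤ :=
    { toFun := fun v => (v.1 + v.2, v.2)
      invFun := fun v => (v.1 - v.2, v.2)
      left_inv := fun v => by ext <;> simp
      right_inv := fun v => by ext <;> simp
      map_add' := fun v w => by ext <;> simp only [Prod.fst_add, Prod.snd_add]; ring }
  let sh : V ≃* V := AddEquiv.toMultiplicative shA
  have hsh : ∀ v : ℤ × ℤ, sh (Multiplicative.ofAdd v) = Multiplicative.ofAdd (v.1 + v.2, v.2) := fun v => rfl
  have hshσ : ∀ s : S, (φ₁ s).trans sh = sh.trans (φ₁ s) := fun s => by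
    refine MulEquiv.ext fun v => ?_
    rcases hcases s with rfl | rfl
    · rw [hφ₁0]; rfl
    · rw [hφ₁1, MulEquiv.trans_apply, MulEquiv.trans_apply, hσ, hσ, map_inv]
  let τ : MulAut Y := SemidirectProduct.congr sh (MulEquiv.refl S) hshσ
  let ψ : Multiplicative ℤ →* MulAut Y := zpowersHom (MulAut Y) τ
  -- invariants of all powers of `τ`: `right` and the second coordinate are preserved
  let Tsub : Subgroup (MulAut Y) :=
    { carrier := {e | ∀ y : Y, (e y).right = y.right ∧
        (Multiplicative.toAdd (e y).left).2 = (Multiplicative.toAdd y.left).2}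
      mul_mem' := fun {e e'} he he' => fun y => by
        rw [MulAut.mul_apply]
        exact ⟨(he _).1.trans (he' y).1, (he _).2.trans (he' y).2⟩
      one_mem' := fun y => ⟨rfl, rfl⟩
      inv_mem' := fun {e} he => fun y => by
        have h := he (e⁻¹ y)
        rw [MulAut.apply_inv_self] at h
        exact ⟨h.1.symm, h.2.symm⟩ }
  have hτT : τ ∈ Tsub := fun y => ⟨rfl, rfl⟩
  have hψT : ∀ g : Multiplicative ℤ, ψ g ∈ Tsub := fun g => by
    change τ ^ (Multiplicative.toAdd g) ∈ Tsub
    exact Tsub.zpow_mem hτT _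
  -- explicit action of `τⁿ` on translations
  have hψn : ∀ n : ℤ, ψ (Multiplicative.ofAdd n) = τ ^ n := fun n => by
    change τ ^ (Multiplicative.toAdd (Multiplicative.ofAdd n)) = τ ^ n
    rw [toAdd_ofAdd]
  have hτinl : ∀ v : ℤ × ℤ, τ (SemidirectProduct.inl (Multiplicative.ofAdd v)) =
      SemidirectProduct.inl (Multiplicative.ofAdd (v.1 + v.2, v.2)) := fun v =>
    SemidirectProduct.ext (hsh v) rfl
  have hτinl' : ∀ v : ℤ × ℤ, τ⁻¹ (SemidirectProduct.inl (Multiplicative.ofAdd v)) =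
      SemidirectProduct.inl (Multiplicative.ofAdd (v.1 - v.2, v.2)) := fun v => by
    rw [MulAut.inv_apply, MulEquiv.symm_apply_eq, hτinl]
    congr 2
    ext <;> simp
  have hψv : ∀ (n : ℤ) (v : ℤ × ℤ), (τ ^ n) (SemidirectProduct.inl (Multiplicative.ofAdd v)) =
      SemidirectProduct.inl (Multiplicative.ofAdd (v.1 + n * v.2, v.2)) := by
    intro n
    induction n using Int.induction_on with
    | zero => intro v; rw [zpow_zero, MulAut.one_apply, zero_mul, add_zero]
    | succ n ih =>
      intro v
      rw [zpow_add_one, MulAut.mul_apply, hτinl, ih]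
      congr 2
      ext <;> simp; ring
    | pred n ih =>
      intro v
      rw [zpow_sub_one, MulAut.mul_apply, hτinl', ih]
      congr 2
      ext <;> simp; ring
  have hψc : ∀ n : ℤ, (ψ (Multiplicative.ofAdd n)) (SemidirectProduct.inl (Multiplicative.ofAdd ((0 : ℤ), (1 : ℤ)))) =
      SemidirectProduct.inl (Multiplicative.ofAdd (n, (1 : ℤ))) := fun n => by
    rw [hψn, hψv]
    congr 2
    ext <;> simp
  let P : Type := Y ⋊[ψ] Multiplicative ℤ
  letI : TopologicalSpace P := ⊥
  haveI : DiscreteTopology P := ⟨rfl⟩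
  -- conjugation of `inl`-elements in `Π_X` and in `Π_Y`
  have hconjP : ∀ (x : P) (m : Y), x * SemidirectProduct.inl m * x⁻¹ =
      SemidirectProduct.inl (x.left * ψ x.right m * x.left⁻¹) := fun x m => by
    refine SemidirectProduct.ext ?_ ?_
    · rw [SemidirectProduct.mul_left, SemidirectProduct.mul_left, SemidirectProduct.inv_left,
        SemidirectProduct.left_inl, SemidirectProduct.mul_right, SemidirectProduct.right_inl, mul_one,
        ← MulAut.mul_apply, ← map_mul, mul_inv_cancel, map_one, MulAut.one_apply, SemidirectProduct.left_inl]
    · rw [SemidirectProduct.mul_right, SemidirectProduct.mul_right, SemidirectProduct.inv_right,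
        SemidirectProduct.right_inl, mul_one, mul_inv_cancel, SemidirectProduct.right_inl]
  have hconjY : ∀ (y : Y) (v : V), y * SemidirectProduct.inl v * y⁻¹ = SemidirectProduct.inl (φ₁ y.right v) :=
    fun y v => by
    refine SemidirectProduct.ext ?_ ?_
    · rw [SemidirectProduct.mul_left, SemidirectProduct.mul_left, SemidirectProduct.inv_left,
        SemidirectProduct.left_inl, SemidirectProduct.mul_right, SemidirectProduct.right_inl, mul_one,
        ← MulAut.mul_apply, ← map_mul, mul_inv_cancel, map_one, MulAut.one_apply, SemidirectProduct.left_inl,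
        mul_inv_cancel_comm]
    · rw [SemidirectProduct.mul_right, SemidirectProduct.mul_right, SemidirectProduct.inv_right,
        SemidirectProduct.right_inl, mul_one, mul_inv_cancel, SemidirectProduct.right_inl]
  -- subgroups
  let PiY : Subgroup P := (SemidirectProduct.rightHom : P →* Multiplicative ℤ).ker
  have mem_PiY : ∀ x : P, x ∈ PiY ↔ x.right = 1 := fun x => Iff.rfl
  let L : P →* S :=
    { toFun := fun x => x.left.right
      map_one' := rfl
      map_mul' := fun x y => by
        change (x * y).left.right = x.left.right * y.left.right
        rw [SemidirectProduct.mul_left, SemidirectProduct.mul_right, ((hψT x.right) y.left).1] }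
  let PiYdd : Subgroup P := L.ker ⊓ PiY
  have mem_PiYdd : ∀ x : P, x ∈ PiYdd ↔ x.left.right = 1 ∧ x.right = 1 := fun x => Iff.rfl
  haveI hPiYdd_normal : PiYdd.Normal := inferInstance
  have hinl2 : ∀ x : P, x ∈ PiYdd →
      SemidirectProduct.inl (SemidirectProduct.inl x.left.left) = x := fun x hx => by
    obtain ⟨h1, h2⟩ := (mem_PiYdd x).mp hx
    refine SemidirectProduct.ext (SemidirectProduct.ext rfl ?_) ?_
    · rw [SemidirectProduct.left_inl, SemidirectProduct.right_inl, h1]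
    · rw [SemidirectProduct.right_inl, h2]
  -- coordinates: `b(x)` = second coordinate of the `V`-part
  have hb_mul : ∀ x y : P, x ∈ PiYdd → y ∈ PiYdd →
      (Multiplicative.toAdd (x * y).left.left).2 =
        (Multiplicative.toAdd x.left.left).2 + (Multiplicative.toAdd y.left.left).2 := fun x y hx hy => by
    obtain ⟨hx1, hx2⟩ := (mem_PiYdd x).mp hx
    rw [SemidirectProduct.mul_left, hx2, map_one, MulAut.one_apply, SemidirectProduct.mul_left, hx1, hφ₁0,
      MulAut.one_apply, toAdd_mul, Prod.snd_add]
  have hconj_dd : ∀ (g x : P), x ∈ PiYdd → g * x * g⁻¹ ∈ PiYdd ∧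
      ((Multiplicative.toAdd (g * x * g⁻¹).left.left).2 = (Multiplicative.toAdd x.left.left).2 ∨
        (Multiplicative.toAdd (g * x * g⁻¹).left.left).2 = -(Multiplicative.toAdd x.left.left).2) := by
    intro g x hx
    have hgx : g * x * g⁻¹ = SemidirectProduct.inl (SemidirectProduct.inl
        (φ₁ g.left.right ((ψ g.right (SemidirectProduct.inl x.left.left)).left))) := by
      conv_lhs => rw [← hinl2 x hx]
      rw [hconjP, ← hconjY]
      congr 1
      have hr : (ψ g.right (SemidirectProduct.inl x.left.left)).right = 1 := by
        rw [((hψT g.right) _).1, SemidirectProduct.right_inl]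
      conv_lhs => rw [← SemidirectProduct.inl_left_mul_inr_right (ψ g.right (SemidirectProduct.inl x.left.left)),
        hr, map_one, mul_one]
    have h2 : (Multiplicative.toAdd (ψ g.right (SemidirectProduct.inl x.left.left)).left).2 =
        (Multiplicative.toAdd x.left.left).2 := by
      rw [((hψT g.right) _).2, SemidirectProduct.left_inl]
    rw [hgx]
    refine ⟨(mem_PiYdd _).mpr ⟨rfl, rfl⟩, ?_⟩
    rw [SemidirectProduct.left_inl, SemidirectProduct.left_inl]
    rcases hφ₁v g.left.right ((ψ g.right (SemidirectProduct.inl x.left.left)).left) with h | h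
    · exact Or.inl (by rw [h, h2])
    · exact Or.inr (by rw [h, toAdd_inv, Prod.snd_neg, h2])
  -- `thetaMod = η₀ : x ↦ b(x) mod 2` and `Ker ↠ Θ = {b even}`
  let θf : P → Multiplicative (ZMod 2) := fun x =>
    Multiplicative.ofAdd (((Multiplicative.toAdd x.left.left).2 : ℤ) : ZMod 2)
  have θf_mul : ∀ x y : P, x ∈ PiYdd → y ∈ PiYdd → θf (x * y) = θf x * θf y := fun x y hx hy => by
    change Multiplicative.ofAdd _ = Multiplicative.ofAdd _ * Multiplicative.ofAdd _
    rw [hb_mul x y hx hy, Int.cast_add, ofAdd_add]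
  have θf_conj : ∀ g x : P, x ∈ PiYdd → θf (g * x * g⁻¹) = θf x := fun g x hx => by
    change Multiplicative.ofAdd _ = Multiplicative.ofAdd _
    rcases (hconj_dd g x hx).2 with h | h
    · rw [h]
    · rw [h, Int.cast_neg, ZMod.neg_eq_self_mod_two]
  let K : Subgroup P :=
    { carrier := {x | x ∈ PiYdd ∧ (2 : ℤ) ∣ (Multiplicative.toAdd x.left.left).2}
      mul_mem' := fun {x y} hx hy => ⟨PiYdd.mul_mem hx.1 hy.1, by
        rw [hb_mul x y hx.1 hy.1]; exact dvd_add hx.2 hy.2⟩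
      one_mem' := ⟨PiYdd.one_mem, by simp⟩
      inv_mem' := fun {x} hx => ⟨PiYdd.inv_mem hx.1, by
        have h := hb_mul x⁻¹ x (PiYdd.inv_mem hx.1) hx.1
        rw [inv_mul_cancel] at h
        have h0 : (Multiplicative.toAdd (1 : P).left.left).2 = 0 := rfl
        rw [h0] at h
        have : (Multiplicative.toAdd x⁻¹.left.left).2 = -(Multiplicative.toAdd x.left.left).2 := by linarith
        rw [this]; exact (dvd_neg).mpr hx.2⟩ }
  have mem_K : ∀ x : P, x ∈ K ↔ x ∈ PiYdd ∧ (2 : ℤ) ∣ (Multiplicative.toAdd x.left.left).2 := fun x => Iff.rfl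
  have hK_normal : K.Normal := ⟨fun x hx g => (mem_K _).mpr ⟨(hconj_dd g x hx.1).1, by
    rcases (hconj_dd g x hx.1).2 with h | h
    · rw [h]; exact hx.2
    · rw [h]; exact (dvd_neg).mpr hx.2⟩⟩
  have θf_eq_one : ∀ x : P, θf x = 1 ↔ (2 : ℤ) ∣ (Multiplicative.toAdd x.left.left).2 := fun x => by
    change Multiplicative.ofAdd _ = 1 ↔ _
    rw [ofAdd_eq_one, ZMod.intCast_zmod_eq_zero_iff_dvd]
    norm_num
  -- distinguished elements
  let c₀ : V := Multiplicative.ofAdd ((0 : ℤ), (1 : ℤ))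
  let s₁ : S := Multiplicative.ofAdd 1
  let xc : P := SemidirectProduct.inl (SemidirectProduct.inl c₀)
  let xs : P := SemidirectProduct.inl (SemidirectProduct.inr s₁)
  have hxc : xc ∈ PiYdd := (mem_PiYdd _).mpr ⟨rfl, rfl⟩
  have hxs : xs ∈ PiY := rfl
  have index_PiYdd : (PiYdd.subgroupOf PiY).index = 2 := by
    change PiYdd.relIndex PiY = 2
    rw [Subgroup.inf_relIndex_right, Subgroup.relIndex_ker]
    have hmap : PiY.map L = ⊤ := by
      refine top_le_iff.mp fun t _ => ?_
      rcases hcases t with rfl | rfl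
      · exact ⟨1, PiY.one_mem, map_one L⟩
      · exact ⟨xs, hxs, rfl⟩
    rw [hmap, Subgroup.card_top, Nat.card_eq_fintype_card]
    rfl
  let η₀ : PiYdd → Multiplicative (ZMod 2) := fun y => θf y
  let R : RigidData.{0} 2 1 :=
    { PiX := P
      G := PUnit
      aug := 1
      aug_surjective := fun _ => ⟨1, Subsingleton.elim _ _⟩
      PiY := PiY
      PiY_normal := MonoidHom.normal_ker _
      PiY_open := isOpen_discrete _
      galYX := QuotientGroup.quotientKerEquivOfSurjective _ SemidirectProduct.rightHom_surjective
      PiYdd := PiYdd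
      PiYdd_le := inf_le_right
      PiYdd_normal := hPiYdd_normal
      PiYdd_open := isOpen_discrete _
      index_PiYdd := index_PiYdd
      mu := Multiplicative (ZMod 2)
      mu_cyclic := inferInstance
      card_mu := rfl
      chi := 1
      chi_ker_open := isOpen_discrete _
      thetaCocycles := {η₀}
      thetaCocycles_nonempty := Set.singleton_nonempty _
      isCocycle := by
        rintro η hη
        rw [Set.mem_singleton_iff] at hη
        subst hη
        intro x y
        change θf ((x : P) * y) = θf x * θf y
        exact θf_mul x y x.2 y.2
      locallyConstant := fun η _ => IsLocallyConstant.of_discrete η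
      mul_coboundary_mem := by
        rintro η hη c
        rw [Set.mem_singleton_iff] at hη ⊢
        subst hη
        funext x
        simp [CycEnvelope.coboundary]
      thetaKer := K
      thetaKer_normal := hK_normal
      thetaKer_le := by rw [MonoidHom.ker_one]; exact le_inf (fun x hx => hx.1) le_top
      lDeltaTheta := PiYdd
      thetaKer_le_lDeltaTheta := fun x hx => hx.1
      lDeltaTheta_le := by rw [MonoidHom.ker_one]; exact le_inf le_rfl le_top
      lDeltaTheta_normal := hPiYdd_normal
      thetaMod := MonoidHom.mk' (fun g => θf g) fun g h => θf_mul g h g.2 h.2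
      thetaMod_surjective := by
        intro m
        rcases hcases m with rfl | rfl
        · exact ⟨1, map_one _⟩
        · exact ⟨⟨xc, hxc⟩, rfl⟩
      thetaMod_ker := by
        rintro ⟨g, hg⟩
        change θf g = 1 ↔ _
        rw [θf_eq_one]
        constructor
        · intro h2
          exact ⟨g, (mem_K g).mpr ⟨hg, h2⟩, 1, by simp⟩
        · rintro ⟨k, hk, ⟨h, hh⟩, hkh⟩
          have hkh' : g = k * (h * h) := by simpa [pow_two] using hkh
          rw [← θf_eq_one, hkh', θf_mul k (h * h) hk.1 (PiYdd.mul_mem hh hh), θf_mul h h hh hh, hsq, mul_one]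
          exact (θf_eq_one k).mpr hk.2
      thetaMod_conj := fun x g => by
        change θf (x * (g : P) * x⁻¹) = (1 : MulAut (Multiplicative (ZMod 2))) (θf g)
        rw [θf_conj x g g.2, MulAut.one_apply]
      cocycle_thetaKer := by
        rintro η hη y hy
        have h1 : η = η₀ := hη
        subst h1
        exact (θf_eq_one _).mpr ((mem_K _).mp hy).2
      cocycle_lDeltaTheta := by
        rintro η hη y hy
        have h1 : η = η₀ := hη
        subst h1
        rfl
      cuspY := fun _ => ∅
      cuspX := fun _ => ∅
      cuspX_neg := fun _ => rfl
      augYdd_surjective := fun _ => ⟨1, Subsingleton.elim _ _⟩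
      thetaSections_conj := by
        intro η η' hη hη'
        have h1 : η = η₀ := hη
        have h2 : η' = η₀ := hη'
        subst h1 h2
        exact ThetaEnvData.IsKLConjugate.base }
  refine ⟨R, ⟨⟨xc, (Subgroup.mem_inf.mp hxc).2⟩, ⟨xs, hxs⟩, fun h => ?_⟩, fun x hx => ?_⟩
  · -- `Π_Y` is not abelian: the translation `(0,1)` and the reflection do not commute
    have h1 : xc * xs = xs * xc := congrArg Subtype.val h
    have h2 := congrArg (fun z : P => (Multiplicative.toAdd z.left.left).2) h1
    change (Multiplicative.toAdd (c₀ * φ₁ 1 1)).2 = (Multiplicative.toAdd (1 * φ₁ s₁ c₀)).2 at h2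
    rw [hφ₁0, hφ₁1, MulAut.one_apply, mul_one, one_mul, hσ, toAdd_inv, Prod.snd_neg] at h2
    change (1 : ℤ) = -1 at h2
    omega
  · -- Cor. 2.18 (iii), `Π_X`-part: an `x` centralising `Π_Y` is trivial
    -- (1) test against the translation `(0, 1)`: `n = 0` and `x.left` acts by `+1`
    have hc := hx ⟨xc, (Subgroup.mem_inf.mp hxc).2⟩
    change x * xc * x⁻¹ = xc at hc
    rw [hconjP] at hc
    have hc' := SemidirectProduct.inl_injective hc
    obtain ⟨n, hn⟩ : ∃ n : ℤ, x.right = Multiplicative.ofAdd n := ⟨Multiplicative.toAdd x.right, rfl⟩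
    rw [hn, hψc n, hconjY] at hc'
    have hc'' := SemidirectProduct.inl_injective hc'
    have hn0 : n = 0 ∧ φ₁ x.left.right (Multiplicative.ofAdd (n, (1 : ℤ))) = Multiplicative.ofAdd (n, (1 : ℤ)) := by
      rcases hφ₁v x.left.right (Multiplicative.ofAdd (n, (1 : ℤ))) with h | h
      · rw [h] at hc''
        have := congrArg (fun v : V => (Multiplicative.toAdd v).1) hc''
        change n = (0 : ℤ) at this
        exact ⟨this, h⟩
      · rw [h] at hc''
        have := congrArg (fun v : V => (Multiplicative.toAdd v).2) hc''
        change (Multiplicative.toAdd ((Multiplicative.ofAdd (n, (1 : ℤ)))⁻¹)).2 = (1 : ℤ) at this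
        rw [toAdd_inv, toAdd_ofAdd, Prod.snd_neg] at this
        exfalso; omega
    obtain ⟨rfl, hfix⟩ := hn0
    -- `x.left.right = 1`: otherwise it would act by `−1` on `(0, 1)`
    have hxr : x.left.right = 1 := by
      rcases hcases x.left.right with h | h
      · exact h
      · rw [h, hφ₁1, hσ] at hfix
        have := congrArg (fun v : V => (Multiplicative.toAdd v).2) hfix
        change (Multiplicative.toAdd ((Multiplicative.ofAdd ((0 : ℤ), (1 : ℤ))))⁻¹).2 = (1 : ℤ) at this
        rw [toAdd_inv, toAdd_ofAdd, Prod.snd_neg] at this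
        exfalso; omega
    -- (2) test against the reflection: `x.left.left² = 1`
    have hs' := hx ⟨xs, hxs⟩
    change x * xs * x⁻¹ = xs at hs'
    rw [hconjP] at hs'
    have hs'' := SemidirectProduct.inl_injective hs'
    rw [hn, ofAdd_zero, map_one, MulAut.one_apply] at hs''
    have hl := congrArg SemidirectProduct.left hs''
    rw [SemidirectProduct.mul_left, SemidirectProduct.mul_left, SemidirectProduct.left_inr, SemidirectProduct.inv_left,
      SemidirectProduct.mul_right, SemidirectProduct.right_inr, hxr, inv_one, hφ₁0, MulAut.one_apply,
      MulAut.one_apply, mul_one, one_mul, hφ₁1, hσ, inv_inv] at hl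
    -- hl : `w * w = 1`
    have hw : x.left.left = 1 := by
      have h2 := congrArg (fun v : V => Multiplicative.toAdd v) hl
      rw [toAdd_mul, toAdd_one] at h2
      apply Multiplicative.toAdd.injective
      rw [toAdd_one]
      refine Prod.ext ?_ ?_
      · have := congrArg Prod.fst h2; simp only [Prod.fst_add, Prod.fst_zero] at this
        change _ = (0 : ℤ); omega
      · have := congrArg Prod.snd h2; simp only [Prod.snd_add, Prod.snd_zero] at this
        change _ = (0 : ℤ); omega
    refine SemidirectProduct.ext (SemidirectProduct.ext hw hxr) ?_
    rw [hn, ofAdd_zero]; rfl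

end RigidData

end Literature.AnabelianGeometry.EtaleTheta
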